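import Summits.Ventures.WeilGRH.ModulationCostSecondOrder
import Summits.Ventures.WeilGRH.ModulationCostConstants
import Summits.Ventures.WeilGRH.TwistedModulationCost
import Literature.NumberTheory.LFunctions.RiemannSiegelFacts
import Literature.Analysis.SpecialFunctions.DigammaStirlingSecondOrder
import HarnessLib

/-!
# rh-explicit (venture WeilGRH): THE ARCHIMEDEAN BUDGETS OF A MODULATED WINDOW TO SECOND ORDER (weil-3 gen14)

Cell `rh-explicit`, WEIL TRACK (structure seat weil-3, gen14).  RH-free real analysis; no measure, no zeros.

With the second-order oscillatory increment `|∫₀^∞ ρ(t) min(t,2a) cos(τt) dt| ≤ δ₂(a,τ)`,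
`δ₂(a,τ) = 0.75/τ² + 2.89/|τ|³ + E(a)/(¼ + τ²)` (`ModulationCostSecondOrder`), the archimedean part of the window value
of `u_τ = e^{−iτx}χ_0`, namely `−K₀ + ∫₀^∞ ρ(t)(2(1 − cos τt) + cos(τt) min(t,2a)/a) dt`
(`K₀ = log 4π + γ + 2∫₀^∞ (e^{t/2} − 1)/(2 sinh t) dt`, `∫ρ·2(1 − cos τt) = Re ψ(¼+iτ/2) − Re ψ(¼)`), is `log(|τ|/2π)` up to
`O(1/τ²)` ON BOTH SIDES (`a > 0`, `|τ| ≥ 2`):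

* `integral_modulationCost_zero_le_second` / `integral_modulationCost_zero_ge_second`:
  `|∫ρ(2(1 − cos τt) + cos τt·min(t,2a)/a) − [Re ψ(¼+iτ/2) − Re ψ(¼)]| ≤ δ₂(a,τ)/a`;
* **`archBudget_le_second`**: `−K₀ + ∫ρ(…) ≤ log(|τ|/2π) + 2/τ² + δ₂(a,τ)/a`;
* **`log_height_le_archBudget_second`**: `log(|τ|/2π) − 2.3/τ² − δ₂(a,τ)/a ≤ −K₀ + ∫ρ(…)`
  (second-order Stirling for `Re ψ` on the quarter line, `RiemannSiegelStirling.abs_re_digamma_sub_log_norm_add_re_le`).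

* `abs_im_digamma_quarter_sub_le_stirling` (`1 ≤ ω ≤ ω′`): `|Im ψ(¼+iω′/2) − Im ψ(¼+iω/2)| ≤ 1/ω + ε(ω) + ε(ω′)`,
  `ε(ω) = 4/(3ω³) + π/(3ω²)` (second-order Stirling for `Im ψ`, `DigammaStirlingSecondOrder`; the gen13 tree lemma
  `YoshidaGramEntryBoundsPrelim.abs_im_digamma_quarter_sub_le` has `4(ω′−ω)/ω`) — the companion for the cross terms.

* `abs_poleCross_numerator_mul_le`: the Cauchy–Schwarz inequality for the pole cross numerator of two modulated
  windows (pure algebra; consumed by `WeilMeasureFirstZero.norm_weilPoleSesq_modulated_pair_le_four`).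

These replace the `(2/|τ| + 2/τ²)/a` of `ZetaWindowPhaseBlind.archBudget_phaseBlind_le` (gen11) and
`ZetaWindowLowerBound.log_height_le_archBudget` (gen12): every window budget of the chain — the `δ±_a(τ)` of the
Beurling–Selberg laws, the first-zero window — improves by `≈ 2/(a|τ|)` (`0.17` at the first-zero height of the frontier rung).
Imports are built modules only (+ `ModulationCostSecondOrder`).  No definitions, no named facts; RH-free.
-/

set_option autoImplicit false

noncomputable section

open Complex Filter Set MeasureTheory
open scoped Real Topology

namespace Summit.Ventures.WeilGRH

open Literature.NumberTheory.LFunctions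
open Literature.Analysis.SpecialFunctions (digammaNode digammaNode_pos reDigammaQuarter)

variable {a : ℝ}

/-! ## `Im ψ` on the quarter line to second order -/

/-- `Im (1/(2(¼ + iω/2))) = −ω/(¼ + ω²)`. -/
theorem im_one_div_two_mul_quarter (y : ℝ) :
    (1 / (2 * (1 / 4 + (y : ℂ) / 2 * I))).im = -y / (1 / 4 + y ^ 2) := by
  have hz : 2 * (1 / 4 + (y : ℂ) / 2 * I) = ⟨1 / 2, y⟩ := by
    apply Complex.ext <;> simp <;> ring
  rw [hz, one_div, Complex.inv_im, Complex.normSq_mk]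
  ring

/-- Second-order Stirling on the quarter line: `|Im ψ(¼+iω/2) − (π/2 − arctan(1/(2ω))) − ω/(¼+ω²)| ≤ 4/(3ω³) + π/(3ω²)`
for `ω > 0`. -/
theorem abs_im_digamma_quarter_sub_stirling_le {y : ℝ} (hy : 0 < y) :
    |(Complex.digamma (1 / 4 + (y : ℂ) / 2 * I)).im - (π / 2 - Real.arctan (1 / (2 * y))) - y / (1 / 4 + y ^ 2)| ≤
      4 / (3 * y ^ 3) + π / (3 * y ^ 2) := by
  set w : ℂ := 1 / 4 + (y : ℂ) / 2 * I with hw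
  have hre : w.re = 1 / 4 := by simp [hw]
  have him : w.im = y / 2 := by simp [hw]
  have hre0 : 0 < w.re := by rw [hre]; norm_num
  have him0 : 0 < w.im := by rw [him]; positivity
  have h := Literature.Analysis.SpecialFunctions.Complex.abs_im_digamma_sub_arg_add_im_le hre0 him0
  have harg : arg w = π / 2 - Real.arctan (1 / (2 * y)) := by
    rw [Literature.Analysis.SpecialFunctions.Complex.arg_eq_pi_div_two_sub_arctan hre0 him0, hre, him]
    congr 2; field_simp; ring
  have hi : (1 / (2 * w)).im = -y / (1 / 4 + y ^ 2) := im_one_div_two_mul_quarter y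
  rw [harg, hi, him, abs_of_pos (by positivity : (0 : ℝ) < y / 2)] at h
  have e1 : 1 / (6 * (y / 2) ^ 3) + π / (12 * (y / 2) ^ 2) = 4 / (3 * y ^ 3) + π / (3 * y ^ 2) := by
    field_simp; ring
  rw [e1] at h
  have e2 : (Complex.digamma w).im - (π / 2 - Real.arctan (1 / (2 * y))) + -y / (1 / 4 + y ^ 2) =
      (Complex.digamma w).im - (π / 2 - Real.arctan (1 / (2 * y))) - y / (1 / 4 + y ^ 2) := by ring
  rwa [e2] at h

/-- **`|Im ψ(¼ + iω′/2) − Im ψ(¼ + iω/2)| ≤ 1/ω + ε(ω) + ε(ω′)`**, `ε(ω) = 4/(3ω³) + π/(3ω²)`, for `1 ≤ ω ≤ ω′`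
(the main terms `arctan(1/2ω) − arctan(1/2ω′) ∈ [0, 1/(2ω)]` and `ω′/(¼+ω′²) − ω/(¼+ω²) ∈ [−1/ω, 0]` have opposite signs). -/
theorem abs_im_digamma_quarter_sub_le_stirling {y y' : ℝ} (hy : 1 ≤ y) (hyy' : y ≤ y') :
    |(Complex.digamma (1 / 4 + (y' : ℂ) / 2 * I)).im - (Complex.digamma (1 / 4 + (y : ℂ) / 2 * I)).im| ≤
      1 / y + (4 / (3 * y ^ 3) + π / (3 * y ^ 2)) + (4 / (3 * y' ^ 3) + π / (3 * y' ^ 2)) := by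
  have hy0 : 0 < y := by linarith
  have hy0' : 0 < y' := by linarith
  have h := abs_im_digamma_quarter_sub_stirling_le hy0
  have h' := abs_im_digamma_quarter_sub_stirling_le hy0'
  rw [abs_le] at h h'
  -- main terms
  have hb1 : 0 ≤ Real.arctan (1 / (2 * y)) - Real.arctan (1 / (2 * y')) := by
    have : Real.arctan (1 / (2 * y')) ≤ Real.arctan (1 / (2 * y)) :=
      Real.arctan_strictMono.monotone (div_le_div_of_nonneg_left (by norm_num) (by positivity) (by linarith))
    linarith
  have hb1' : Real.arctan (1 / (2 * y)) - Real.arctan (1 / (2 * y')) ≤ 1 / (2 * y) := by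
    have h1 : Real.arctan (1 / (2 * y)) ≤ 1 / (2 * y) := by
      have := Real.le_tan (Real.arctan_nonneg.2 (by positivity : (0 : ℝ) ≤ 1 / (2 * y)))
        (Real.arctan_lt_pi_div_two _)
      rwa [Real.tan_arctan] at this
    have h2 : 0 ≤ Real.arctan (1 / (2 * y')) := Real.arctan_nonneg.2 (by positivity)
    linarith
  have hb2 : y' / (1 / 4 + y' ^ 2) - y / (1 / 4 + y ^ 2) ≤ 0 := by
    rw [sub_nonpos, div_le_div_iff₀ (by positivity) (by positivity)]
    nlinarith [mul_nonneg (sub_nonneg.2 hyy') (by nlinarith : (0 : ℝ) ≤ y * y' - 1 / 4)]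
  have hb2' : -(1 / y) ≤ y' / (1 / 4 + y' ^ 2) - y / (1 / 4 + y ^ 2) := by
    have h1 : y / (1 / 4 + y ^ 2) ≤ 1 / y := by
      rw [div_le_div_iff₀ (by positivity) hy0]; nlinarith
    have h2 : 0 ≤ y' / (1 / 4 + y' ^ 2) := by positivity
    linarith
  have h12 : 1 / (2 * y) ≤ 1 / y := div_le_div_of_nonneg_left (by norm_num) hy0 (by linarith)
  rw [abs_le]
  constructor <;> nlinarith

/-! ## Cauchy–Schwarz for the pole cross numerator (used by `WeilMeasureFirstZero`) -/

/-- Cauchy–Schwarz for the pole cross numerator: with `C² = S² + 1`, `si² + co² = si′² + co′² = 1`,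
`|xx′ − yy′|·|θ||θ′| ≤ 4C²(¼+θ²)(¼+θ′²)` for `x = S co + 2θ C si`, `y = C si − 2θ S co` (and primed),
since `x² + y² = (S²co² + C²si²)(1 + 4θ²) ≤ 4C²(¼+θ²)` and `(xx′ − yy′)² ≤ (x²+y²)(x′²+y′²)`. -/
theorem abs_poleCross_numerator_mul_le (S C co si co' si' θ θ' : ℝ) (hC : C ^ 2 = S ^ 2 + 1)
    (h1 : si ^ 2 + co ^ 2 = 1) (h1' : si' ^ 2 + co' ^ 2 = 1) :
    |(S * co + 2 * θ * C * si) * (S * co' + 2 * θ' * C * si') -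
        (C * si - 2 * θ * S * co) * (C * si' - 2 * θ' * S * co')| * (|θ| * |θ'|) ≤
      4 * C ^ 2 * ((1 / 4 + θ ^ 2) * (1 / 4 + θ' ^ 2)) := by
  set x := S * co + 2 * θ * C * si with hx
  set x' := S * co' + 2 * θ' * C * si' with hx'
  set y := C * si - 2 * θ * S * co with hy
  set y' := C * si' - 2 * θ' * S * co' with hy'
  have hxy : x ^ 2 + y ^ 2 ≤ 4 * C ^ 2 * (1 / 4 + θ ^ 2) := by
    have e : x ^ 2 + y ^ 2 = (S ^ 2 * co ^ 2 + C ^ 2 * si ^ 2) * (1 + 4 * θ ^ 2) := by rw [hx, hy]; ring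
    have h2 : S ^ 2 * co ^ 2 + C ^ 2 * si ^ 2 ≤ C ^ 2 := by nlinarith [sq_nonneg si, sq_nonneg co, sq_nonneg S]
    rw [e]; nlinarith [sq_nonneg θ]
  have hxy' : x' ^ 2 + y' ^ 2 ≤ 4 * C ^ 2 * (1 / 4 + θ' ^ 2) := by
    have e : x' ^ 2 + y' ^ 2 = (S ^ 2 * co' ^ 2 + C ^ 2 * si' ^ 2) * (1 + 4 * θ' ^ 2) := by rw [hx', hy']; ring
    have h2 : S ^ 2 * co' ^ 2 + C ^ 2 * si' ^ 2 ≤ C ^ 2 := by nlinarith [sq_nonneg si', sq_nonneg co', sq_nonneg S]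
    rw [e]; nlinarith [sq_nonneg θ']
  clear_value x x' y y'
  have hLag : (x * x' - y * y') ^ 2 ≤ (x ^ 2 + y ^ 2) * (x' ^ 2 + y' ^ 2) := by
    nlinarith [sq_nonneg (x * y' + y * x')]
  have hA0 : 0 ≤ x ^ 2 + y ^ 2 := by positivity
  have hB0 : 0 ≤ x' ^ 2 + y' ^ 2 := by positivity
  have hθq : θ ^ 2 ≤ 1 / 4 + θ ^ 2 := by linarith
  have hθq' : θ' ^ 2 ≤ 1 / 4 + θ' ^ 2 := by linarith
  -- `(|xx′ − yy′| |θ||θ′|)² ≤ (4C² q q′)²`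
  have hsq : (|x * x' - y * y'| * (|θ| * |θ'|)) ^ 2 ≤ (4 * C ^ 2 * ((1 / 4 + θ ^ 2) * (1 / 4 + θ' ^ 2))) ^ 2 := by
    have e1 : (|x * x' - y * y'| * (|θ| * |θ'|)) ^ 2 = (x * x' - y * y') ^ 2 * (θ ^ 2 * θ' ^ 2) := by
      rw [mul_pow, mul_pow, sq_abs, sq_abs, sq_abs]
    rw [e1]
    have s1 : (x * x' - y * y') ^ 2 * (θ ^ 2 * θ' ^ 2) ≤
        ((x ^ 2 + y ^ 2) * (x' ^ 2 + y' ^ 2)) * ((1 / 4 + θ ^ 2) * (1 / 4 + θ' ^ 2)) :=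
      mul_le_mul hLag (mul_le_mul hθq hθq' (sq_nonneg _) (by positivity)) (by positivity) (by positivity)
    have s2 : (x ^ 2 + y ^ 2) * (x' ^ 2 + y' ^ 2) ≤ (4 * C ^ 2 * (1 / 4 + θ ^ 2)) * (4 * C ^ 2 * (1 / 4 + θ' ^ 2)) :=
      mul_le_mul hxy hxy' hB0 (by positivity)
    have s3 := mul_le_mul_of_nonneg_right s2 (by positivity : (0 : ℝ) ≤ (1 / 4 + θ ^ 2) * (1 / 4 + θ' ^ 2))
    nlinarith [s1, s3]
  exact (pow_le_pow_iff_left₀ (by positivity) (by positivity) two_ne_zero).1 hsq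

/-! ## The second-order archimedean budgets of the modulated window -/

/-- **The archimedean cost of modulation, second order, from above** (`a > 0`, `|τ| ≥ 2`):
`∫₀^∞ ρ(t)(2(1 − cos τt) + cos(τt) min(t,2a)/a) dt ≤ [Re ψ(¼+iτ/2) − Re ψ(¼)] + δ₂(a,τ)/a`,
`δ₂(a,τ) = 0.75/τ² + 2.89/|τ|³ + E(a)/(¼ + τ²)`. -/
theorem integral_modulationCost_zero_le_second (ha : 0 < a) {τ : ℝ} (hτ : 2 ≤ |τ|) :
    ∫ t in Ioi (0 : ℝ), weilArchDensity t *
        (2 * (1 - Real.cos (τ * t)) + Real.cos (τ * t) * (min t (2 * a) / a)) ≤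
      (reDigammaQuarter τ - reDigammaQuarter 0) +
        (0.75 / τ ^ 2 + 2.89 / |τ| ^ 3 + Real.exp (-a) / (1 - Real.exp (-(4 * a))) / (1 / 4 + τ ^ 2)) / a := by
  have hF := integrableOn_weilArchDensity_modulation τ
  have hG' := integrableOn_weilArchDensityPar_mul_min_mul_cos 0 ha.le τ
  have hG : IntegrableOn (fun t : ℝ ↦ weilArchDensity t * min t (2 * a) * Real.cos (τ * t)) (Ioi 0) := by
    refine hG'.congr_fun (fun t _ ↦ ?_) measurableSet_Ioi
    simp only [weilArchDensityPar_zero_apply]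
  have hsplit : (fun t : ℝ ↦ weilArchDensity t *
      (2 * (1 - Real.cos (τ * t)) + Real.cos (τ * t) * (min t (2 * a) / a))) =
      fun t ↦ weilArchDensity t * (2 * (1 - Real.cos (τ * t))) +
        1 / a * (weilArchDensity t * min t (2 * a) * Real.cos (τ * t)) := by
    funext t
    ring
  rw [hsplit, integral_add hF (hG.const_mul _), integral_const_mul, integral_weilArchDensity_modulationCost τ]
  have hb := (le_abs_self _).trans (abs_integral_weilArchDensity_mul_min_mul_cos_le_second ha hτ)
  have h2 : 1 / a * ∫ t in Ioi (0 : ℝ), weilArchDensity t * min t (2 * a) * Real.cos (τ * t) ≤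
      (0.75 / τ ^ 2 + 2.89 / |τ| ^ 3 + Real.exp (-a) / (1 - Real.exp (-(4 * a))) / (1 / 4 + τ ^ 2)) / a := by
    calc 1 / a * ∫ t in Ioi (0 : ℝ), weilArchDensity t * min t (2 * a) * Real.cos (τ * t)
        ≤ 1 / a * (0.75 / τ ^ 2 + 2.89 / |τ| ^ 3 + Real.exp (-a) / (1 - Real.exp (-(4 * a))) / (1 / 4 + τ ^ 2)) :=
          mul_le_mul_of_nonneg_left hb (by positivity)
      _ = _ := by ring
  linarith

/-- **The archimedean cost of modulation, second order, from below** (`a > 0`, `|τ| ≥ 2`):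
`[Re ψ(¼+iτ/2) − Re ψ(¼)] − δ₂(a,τ)/a ≤ ∫₀^∞ ρ(t)(2(1 − cos τt) + cos(τt) min(t,2a)/a) dt`. -/
theorem integral_modulationCost_zero_ge_second (ha : 0 < a) {τ : ℝ} (hτ : 2 ≤ |τ|) :
    (reDigammaQuarter τ - reDigammaQuarter 0) -
        (0.75 / τ ^ 2 + 2.89 / |τ| ^ 3 + Real.exp (-a) / (1 - Real.exp (-(4 * a))) / (1 / 4 + τ ^ 2)) / a ≤
      ∫ t in Ioi (0 : ℝ), weilArchDensity t *
        (2 * (1 - Real.cos (τ * t)) + Real.cos (τ * t) * (min t (2 * a) / a)) := by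
  have hF := integrableOn_weilArchDensity_modulation τ
  have hG' := integrableOn_weilArchDensityPar_mul_min_mul_cos 0 ha.le τ
  have hG : IntegrableOn (fun t : ℝ ↦ weilArchDensity t * min t (2 * a) * Real.cos (τ * t)) (Ioi 0) := by
    refine hG'.congr_fun (fun t _ ↦ ?_) measurableSet_Ioi
    simp only [weilArchDensityPar_zero_apply]
  have hsplit : (fun t : ℝ ↦ weilArchDensity t *
      (2 * (1 - Real.cos (τ * t)) + Real.cos (τ * t) * (min t (2 * a) / a))) =
      fun t ↦ weilArchDensity t * (2 * (1 - Real.cos (τ * t))) +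
        1 / a * (weilArchDensity t * min t (2 * a) * Real.cos (τ * t)) := by
    funext t
    ring
  rw [hsplit, integral_add hF (hG.const_mul _), integral_const_mul, integral_weilArchDensity_modulationCost τ]
  have hb := (neg_abs_le _).trans' (neg_le_neg (abs_integral_weilArchDensity_mul_min_mul_cos_le_second ha hτ))
  have h2 : -((0.75 / τ ^ 2 + 2.89 / |τ| ^ 3 + Real.exp (-a) / (1 - Real.exp (-(4 * a))) / (1 / 4 + τ ^ 2)) / a) ≤
      1 / a * ∫ t in Ioi (0 : ℝ), weilArchDensity t * min t (2 * a) * Real.cos (τ * t) := by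
    calc -((0.75 / τ ^ 2 + 2.89 / |τ| ^ 3 + Real.exp (-a) / (1 - Real.exp (-(4 * a))) / (1 / 4 + τ ^ 2)) / a)
        = 1 / a * -(0.75 / τ ^ 2 + 2.89 / |τ| ^ 3 + Real.exp (-a) / (1 - Real.exp (-(4 * a))) / (1 / 4 + τ ^ 2)) := by
          ring
      _ ≤ _ := mul_le_mul_of_nonneg_left hb (by positivity)
  linarith

/-- **THE SECOND-ORDER PHASE-BLIND ARCHIMEDEAN BUDGET, UPPER** (`a > 0`, `|τ| ≥ 2`):
`−K₀ + ∫₀^∞ ρ(2(1 − cos τt) + cos(τt) min(t,2a)/a) ≤ log(|τ|/2π) + 2/τ² + δ₂(a,τ)/a`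
(`K₀ = log 4π + γ + 2∫₀^∞(e^{t/2} − 1)/(2 sinh t)`; `ModulationCostConstants.archConstants_le_log_height`). -/
theorem archBudget_le_second (ha : 0 < a) {τ : ℝ} (hτ : 2 ≤ |τ|) :
    -(Real.log (4 * π) + Real.eulerMascheroniConstant +
          2 * ∫ t in Ioi (0 : ℝ), (Real.exp (t / 2) - 1) / (2 * Real.sinh t)) +
        ∫ t in Ioi (0 : ℝ), weilArchDensity t *
          (2 * (1 - Real.cos (τ * t)) + Real.cos (τ * t) * (min t (2 * a) / a)) ≤
      Real.log (|τ| / (2 * π)) + 2 / τ ^ 2 +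
        (0.75 / τ ^ 2 + 2.89 / |τ| ^ 3 + Real.exp (-a) / (1 - Real.exp (-(4 * a))) / (1 / 4 + τ ^ 2)) / a := by
  have h1 := integral_modulationCost_zero_le_second ha hτ
  have h2 := archConstants_le_log_height hτ
  linarith

/-- **THE SECOND-ORDER PHASE-BLIND ARCHIMEDEAN BUDGET, LOWER** (`a > 0`, `|τ| ≥ 2`):
`log(|τ|/2π) − 2.3/τ² − δ₂(a,τ)/a ≤ −K₀ + ∫₀^∞ ρ(2(1 − cos τt) + cos(τt) min(t,2a)/a)`
(second-order Stirling for `Re ψ` on the quarter line, `DigammaStirlingSecondOrder.abs_re_digamma_sub_log_norm_add_re_le`: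
`Re ψ(¼+iτ/2) ≥ log(|τ|/2) − 2.3/τ²`). -/
theorem log_height_le_archBudget_second (ha : 0 < a) {τ : ℝ} (hτ : 2 ≤ |τ|) :
    Real.log (|τ| / (2 * π)) - 2.3 / τ ^ 2 -
        (0.75 / τ ^ 2 + 2.89 / |τ| ^ 3 + Real.exp (-a) / (1 - Real.exp (-(4 * a))) / (1 / 4 + τ ^ 2)) / a ≤
      -(Real.log (4 * π) + Real.eulerMascheroniConstant +
          2 * ∫ t in Ioi (0 : ℝ), (Real.exp (t / 2) - 1) / (2 * Real.sinh t)) +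
        ∫ t in Ioi (0 : ℝ), weilArchDensity t *
          (2 * (1 - Real.cos (τ * t)) + Real.cos (τ * t) * (min t (2 * a) / a)) := by
  have h1 := integral_modulationCost_zero_ge_second ha hτ
  have h3 := flatWindow_const_zero_add_reDigammaQuarter_zero
  have hτ0 : 0 < |τ| := by linarith
  -- second-order Stirling for `Re ψ(¼ + iτ/2)` at `w = ¼ + i|τ|/2` (conjugation symmetry handles `τ < 0`)
  have hψ : Real.log (|τ| / 2) - 2.3 / τ ^ 2 ≤ reDigammaQuarter τ := by
    -- reduce to `|τ|`: `Re ψ(¼ + iτ/2) = Re ψ(¼ + i|τ|/2)`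
    have hsym : reDigammaQuarter τ = reDigammaQuarter |τ| := by
      rcases le_or_gt 0 τ with h | h
      · rw [abs_of_nonneg h]
      · rw [abs_of_neg h, reDigammaQuarter, reDigammaQuarter]
        have e : (1 / 4 + ((-τ : ℝ) : ℂ) / 2 * I) = (starRingEnd ℂ) (1 / 4 + (τ : ℂ) / 2 * I) := by
          apply Complex.ext <;> simp [Complex.conj_ofNat] ; ring
        rw [e, digamma_conj, Complex.conj_re]
    rw [hsym, reDigammaQuarter]
    set w : ℂ := 1 / 4 + ((|τ| : ℝ) : ℂ) / 2 * I with hw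
    have hre : w.re = 1 / 4 := by simp [hw]
    have him : w.im = |τ| / 2 := by simp [hw]
    have hre0 : 0 < w.re := by rw [hre]; norm_num
    have him0 : w.im ≠ 0 := by rw [him]; positivity
    have h := Literature.NumberTheory.LFunctions.Complex.abs_re_digamma_sub_log_norm_add_re_le hre0 him0
    rw [him, abs_le] at h
    have hnsq : ‖w‖ ^ 2 = 1 / 16 + |τ| ^ 2 / 4 := by
      rw [Complex.sq_norm, Complex.normSq_apply, hre, him]; ring
    have hn1 : |τ| / 2 ≤ ‖w‖ := by
      refine (pow_le_pow_iff_left₀ (by positivity) (norm_nonneg _) two_ne_zero).1 ?_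
      rw [hnsq, div_pow]; nlinarith
    have hn0 : 0 < ‖w‖ := lt_of_lt_of_le (by positivity) hn1
    have hlog : Real.log (|τ| / 2) ≤ Real.log ‖w‖ := Real.log_le_log (by positivity) hn1
    have hinv : (1 / (2 * w)).re = 1 / 8 / ‖w‖ ^ 2 := by
      rw [show (1 : ℂ) / (2 * w) = (2 * w)⁻¹ by rw [one_div], Complex.inv_re, Complex.normSq_eq_norm_sq, norm_mul,
        Complex.norm_two, Complex.mul_re, hre]
      simp; ring
    have hi2 : 1 / ‖w‖ ^ 2 ≤ 4 * (1 / |τ| ^ 2) := by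
      rw [show (4 : ℝ) * (1 / |τ| ^ 2) = 4 / |τ| ^ 2 by ring,
        div_le_div_iff₀ (pow_pos hn0 2) (pow_pos hτ0 2), hnsq]; nlinarith
    have hπ4 := Real.pi_lt_d6
    have hτsq : τ ^ 2 = |τ| ^ 2 := (sq_abs τ).symm
    have hi3 : 1 / |τ| ^ 3 ≤ 1 / 2 * (1 / |τ| ^ 2) := by
      rw [div_le_iff₀ (by positivity)]
      have : |τ| ^ 3 = |τ| * |τ| ^ 2 := by ring
      rw [this]
      have h2' : 1 ≤ 1 / 2 * |τ| := by linarith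
      calc (1 : ℝ) ≤ 1 / 2 * |τ| := h2'
        _ = 1 / 2 * (1 / |τ| ^ 2) * (|τ| * |τ| ^ 2) := by field_simp
    rw [hinv, abs_of_pos (by positivity : (0 : ℝ) < |τ| / 2)] at h
    rw [hτsq]
    have e1 : 1 / (6 * (|τ| / 2) ^ 3) = 4 / 3 * (1 / |τ| ^ 3) := by field_simp; ring
    have e2 : Real.pi / (12 * (|τ| / 2) ^ 2) = Real.pi / 3 * (1 / |τ| ^ 2) := by field_simp; ring
    rw [e1, e2] at h
    have e3 : 1 / 8 / ‖w‖ ^ 2 = 1 / 8 * (1 / ‖w‖ ^ 2) := by ring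
    rw [e3] at h
    have e4 : (2.3 : ℝ) / |τ| ^ 2 = 2.3 * (1 / |τ| ^ 2) := by ring
    rw [e4]
    have ht2 : 0 ≤ 1 / |τ| ^ 2 := by positivity
    have hπX : Real.pi / 3 * (1 / |τ| ^ 2) ≤ 1.0472 * (1 / |τ| ^ 2) :=
      mul_le_mul_of_nonneg_right (by linarith [hπ4]) ht2
    linarith [h.1, hlog, hi2, hi3, hπX, ht2]
  have hlogsplit : Real.log (|τ| / (2 * π)) = Real.log (|τ| / 2) - Real.log π := by
    rw [show |τ| / (2 * π) = |τ| / 2 / π by ring, Real.log_div (by positivity) Real.pi_pos.ne']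
  rw [hlogsplit]
  linarith

end Summit.Ventures.WeilGRH

end
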